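import Literature.AlgebraicGeometry.RelativeSpec.GeometricQuotientUniversalBaseChange
import Literature.AlgebraicGeometry.RelativeSpec.GeometricQuotientRecognition
import Literature.AlgebraicGeometry.RelativeSpec.FiniteGroupQuotientGluedProperties
import Mathlib.AlgebraicGeometry.Morphisms.Flat
import Mathlib.AlgebraicGeometry.Morphisms.FinitePresentation
import Mathlib.RingTheory.Flat.Basic
import HarnessLib

/-!
# Geometric quotients by finite groups of invertible order are FLAT over the base
# ([MumfordFogartyKirwan1994] Ch. 1 §2 Thm. 1.1 (proof: Reynolds operator); [KatzMazur1985] A7.1)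

Let the finite group `G` act on `X` over a base `Y` (`RelativeSpec.ActionOver r G`, `r : X → Y`) and
let `p : X → Q` be an AFFINE geometric quotient (`ActionOver.IsGeometricQuotient`, Mumford's (1), (2);
e.g. the tree's glued `X → X/G`, ★ `ActionOver.isGeometricQuotient_gluedMk`) with structure map
`q : Q → Y`, `p ≫ q = r`.  When `|G|` is a unit on `Q` (equivalently on `X`,
★ `IsGeometricQuotient.isUnit_natCast_iff`) the Reynolds operator `|G|⁻¹ ∑_g g` makes every chart
`Γ(Q, V) ⊆ Γ(X, p⁻¹V)` a DIRECT SUMMAND as a `Γ(Q, V)`-module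
(★ `exists_leftInverse_of_range_eq_setOf_forall_eq`), hence as a `Γ(Y, U)`-module; a direct summand of
a flat module is flat (Mathlib `Module.Flat.of_retract`).  Consequently:

* `ActionOver.IsGeometricQuotient.flat_appLE_of_isUnit_card` — chartwise: for affine `U ⊆ Y`,
  `V ⊆ q⁻¹U` with `|G| ∈ Γ(Q, V)ˣ`, `Γ(Y, U) → Γ(Q, V)` is flat as soon as `Γ(Y, U) → Γ(X, p⁻¹V)` is;
* `ActionOver.IsGeometricQuotient.flat_of_isUnit_card` — **`X → Y` flat ⟹ `Q → Y` flat**;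
* `ActionOver.flat_gluedDesc_of_isUnit_card` (`…_base`) — the glued quotient `X/G → Y` of the tree
  (`ActionOver.glued`, `gluedDesc`) over an affine base is flat when `X → Y` is flat and
  `|G| ∈ Γ(X, 𝒪_X)ˣ` (resp. `∈ Γ(Y, 𝒪_Y)ˣ`);
* `ActionOver.locallyOfFinitePresentation_gluedDesc` — `X/G → Y` is locally of finite presentation
  when `X → Y` is locally of finite type and `Y` is locally Noetherian (SGA 1 V Cor. 1.5 +
  Noetherian bookkeeping): together with flatness these are exactly the two instance inputs on
  `X/G → Y` of the fibrewise smoothness criterion EGA IV₄ 17.5.1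
  (★ `Resolution.mem_smoothLocus_of_isRegularLocalRing_stalk_fiber`).

This is the flatness half of «the quotient of a smooth `Y`-scheme by a finite group of order
invertible on `Y` is again well behaved over `Y`» ([KatzMazur1985] A7.1: quotients by finite groups
whose order is invertible on the base commute with arbitrary base change and stay flat / finite
locally free); the fibres of `Q → Y` are the quotients of the fibres of `X → Y` by
★ `ActionOver.isGeometricQuotient_baseChange_of_isUnit_card`.
The hypothesis on `|G|` is what makes this hold over an ARBITRARY base and keeps the fibres honest
(over a Dedekind base torsion-freeness alone gives flatness of `Q → Y`, but without `|G| ∈ 𝒪ˣ` the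
fibres of `Q → Y` are not the quotients of the fibres of `X → Y`, SGA 1 V 1.9 Remarque).  Everything
is proved; no named facts, no definitions.

Mathlib searched (pin): `Module.Flat.of_retract`, `HasRingHomProperty.iff_appLE`,
`HasRingHomProperty.appLE`, `RingHom.Flat`, `RingHom.FinitePresentation.of_finiteType`,
`IsLocallyNoetherian.component_noetherian`, `Scheme.Hom.appLE_comp_appLE`, `IsAffineOpen.preimage`
(all used); Mathlib has no quotients of schemes by finite groups and no Reynolds operator over a
general base ring.

## References

* N. M. Katz, B. Mazur, *Arithmetic Moduli of Elliptic Curves*, Annals of Math. Studies 108 (1985),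
  Appendix A7.1 to Ch. 7 (quotients by finite groups whose order is invertible on the base).
  [KatzMazur1985]
* D. Mumford, J. Fogarty, F. Kirwan, *Geometric Invariant Theory*, 3rd ed. (1994), Ch. 1 §2,
  Thm. 1.1 and its proof (Reynolds operator). [MumfordFogartyKirwan1994]
* A. Grothendieck, *SGA 1*, Exp. V, §1, Prop. 1.9 and Cor. 1.5. [SGA1]
-/

noncomputable section

universe u

open CategoryTheory Limits AlgebraicGeometry Opposite

namespace Literature.AlgebraicGeometry.RelativeSpec

section Algebra

/-- **A direct summand of a flat algebra is flat** (module form used chartwise): if `R → S → A` is a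
tower with `A` flat over `R` and the inclusion `S → A` has an `S`-linear (hence `R`-linear) left
inverse, then `S` is flat over `R`. [folklore] -/
private theorem Module.Flat.of_leftInverse_algebraMap {R S A : Type*} [CommRing R] [CommRing S] [CommRing A]
    [Algebra R S] [Algebra S A] [Algebra R A] [IsScalarTower R S A] [Module.Flat R A]
    (ψ : A →ₗ[S] S) (hψ : ∀ s, ψ (algebraMap S A s) = s) : Module.Flat R S :=
  Module.Flat.of_retract ((Algebra.linearMap S A).restrictScalars R) (ψ.restrictScalars R)
    (LinearMap.ext fun s => hψ s)

end Algebra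

namespace ActionOver

namespace IsGeometricQuotient

variable {X Y Q : Scheme.{u}} {r : X ⟶ Y} {p : X ⟶ Q} {G : Type*} [Group G] {ρ : ActionOver r G}

set_option backward.isDefEq.respectTransparency false

/-- **Chartwise flatness of the quotient over the base.** For an affine geometric quotient
`p : X → Q` by a finite group `G` over `Y` (`p ≫ q = r`), affine opens `U ⊆ Y`, `V ⊆ q⁻¹U` with
`|G| ∈ Γ(Q, V)ˣ`: if `Γ(Y, U) → Γ(X, p⁻¹V)` is flat then so is `Γ(Y, U) → Γ(Q, V)` — the Reynolds
retraction makes `Γ(Q, V)` a direct summand of `Γ(X, p⁻¹V)`.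
[cite: KatzMazur1985, A7.1] [cite: MumfordFogartyKirwan1994, Ch. 1 §2 Thm. 1.1 (proof)] -/
theorem flat_appLE_of_isUnit_card [Finite G] (hq : ρ.IsGeometricQuotient p) [IsAffineHom p]
    (q : Q ⟶ Y) (hpq : p ≫ q = r) (U : Y.affineOpens) (V : Q.affineOpens)
    (hVU : (V : Q.Opens) ≤ q ⁻¹ᵁ (U : Y.Opens)) (hG : IsUnit ((Nat.card G : ℕ) : Γ(Q, (V : Q.Opens))))
    (hflat : (r.appLE U (p ⁻¹ᵁ (V : Q.Opens))
      (by rw [← hpq, Scheme.Hom.comp_preimage]; exact p.preimage_mono hVU)).hom.Flat) :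
    (q.appLE U V hVU).hom.Flat := by
  let A₀ : X.Opens := p ⁻¹ᵁ V.1
  have hA₀U : A₀ ≤ r ⁻¹ᵁ U.1 := by
    rw [← hpq, Scheme.Hom.comp_preimage]; exact p.preimage_mono hVU
  have eA₀ : ∀ g : G, A₀ ≤ (ρ.aut g).hom ⁻¹ᵁ A₀ := ρ.preimage_le_aut_preimage p hq.comp_eq V.1
  letI algS : Algebra Γ(Y, U.1) Γ(Q, V.1) := (q.appLE U.1 V.1 hVU).hom.toAlgebra
  letI algA : Algebra Γ(Q, V.1) Γ(X, A₀) := (p.appLE V.1 A₀ le_rfl).hom.toAlgebra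
  letI algRA : Algebra Γ(Y, U.1) Γ(X, A₀) :=
    ((algebraMap Γ(Q, V.1) Γ(X, A₀)).comp (algebraMap Γ(Y, U.1) Γ(Q, V.1))).toAlgebra
  haveI : IsScalarTower Γ(Y, U.1) Γ(Q, V.1) Γ(X, A₀) := IsScalarTower.of_algebraMap_eq' rfl
  -- the composite `Γ(Y, U) → Γ(Q, V) → Γ(X, p⁻¹V)` is `r♯`, which is flat
  have hcomp : (algebraMap Γ(Q, V.1) Γ(X, A₀)).comp (algebraMap Γ(Y, U.1) Γ(Q, V.1)) =
      (r.appLE U.1 A₀ hA₀U).hom := by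
    change (q.appLE U.1 V.1 hVU ≫ p.appLE V.1 A₀ le_rfl).hom = _
    rw [Scheme.Hom.appLE_comp_appLE]
    simp only [Scheme.Hom.appLE, Scheme.Hom.congr_app hpq, Category.assoc, ← Functor.map_comp]
    rfl
  haveI : Module.Flat Γ(Y, U.1) Γ(X, A₀) := by
    have h : (algebraMap Γ(Y, U.1) Γ(X, A₀)).Flat := by
      change ((algebraMap Γ(Q, V.1) Γ(X, A₀)).comp (algebraMap Γ(Y, U.1) Γ(Q, V.1))).Flat
      rw [hcomp]; exact hflat
    exact RingHom.flat_algebraMap_iff.mp h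
  -- the action on `Γ(X, p⁻¹V)` by `Γ(Q, V)`-algebra maps
  have hLc : ∀ (g : G) (c : Γ(Q, V.1)),
      ρ.actOn A₀ eA₀ g (algebraMap Γ(Q, V.1) Γ(X, A₀) c) = algebraMap Γ(Q, V.1) Γ(X, A₀) c :=
    fun g c => by
    change ρ.actOn (p ⁻¹ᵁ V.1) eA₀ g (p.appLE V.1 A₀ le_rfl c) = p.appLE V.1 A₀ le_rfl c
    rw [← Scheme.Hom.app_eq_appLE]
    exact ρ.actOn_app p hq.comp_eq g V.1 c
  let L : G → (Γ(X, A₀) →ₐ[Γ(Q, V.1)] Γ(X, A₀)) := fun g =>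
    { toRingHom := ρ.actOn A₀ eA₀ g, commutes' := hLc g }
  have hLmul : ∀ (g h : G) (a : Γ(X, A₀)),
      (L (g * h)).toLinearMap a = (L g).toLinearMap ((L h).toLinearMap a) := fun g h a => by
    change ρ.actOn A₀ eA₀ (g * h) a = ρ.actOn A₀ eA₀ g (ρ.actOn A₀ eA₀ h a)
    simp only [actOn_apply]
    rw [← CommRingCat.comp_apply, Scheme.Hom.appLE_comp_appLE]
    have e : (ρ.aut (g * h)⁻¹).hom = (ρ.aut g⁻¹).hom ≫ (ρ.aut h⁻¹).hom := by
      rw [mul_inv_rev, map_mul, Aut.Aut_mul_def]; rfl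
    simp only [Scheme.Hom.appLE, Scheme.Hom.congr_app e, Category.assoc, ← Functor.map_comp]
    rfl
  have hinj₀ : Function.Injective (Algebra.linearMap Γ(Q, V.1) Γ(X, A₀)) := by
    change Function.Injective (p.appLE V.1 A₀ le_rfl)
    rw [← Scheme.Hom.app_eq_appLE]
    exact hq.app_injective V.1
  have hrange : Set.range (Algebra.linearMap Γ(Q, V.1) Γ(X, A₀)) =
      {x | ∀ g : G, (L g).toLinearMap x = x} := by
    change Set.range (p.appLE V.1 A₀ le_rfl) = _
    rw [← Scheme.Hom.app_eq_appLE]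
    exact hq.range_app V.1
  -- the Reynolds retraction splits `p♯`, so `Γ(Q, V)` is a direct summand of the flat `Γ(X, p⁻¹V)`
  obtain ⟨ψ, hψ⟩ := exists_leftInverse_of_range_eq_setOf_forall_eq
    (Algebra.linearMap Γ(Q, V.1) Γ(X, A₀)) hinj₀ (fun g => (L g).toLinearMap) hLmul hrange hG
  have hS : Module.Flat Γ(Y, U.1) Γ(Q, V.1) :=
    Module.Flat.of_leftInverse_algebraMap (R := Γ(Y, U.1)) ψ hψ
  exact RingHom.flat_algebraMap_iff.mpr hS

/-- **The quotient is flat over the base** ([KatzMazur1985] A7.1): for an affine geometric quotient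
`p : X → Q` by a finite group `G` acting over `Y` with `|G| ∈ Γ(Q, 𝒪_Q)ˣ`, and the structure map
`q : Q → Y` (`p ≫ q = r`): `X → Y` flat ⟹ `Q → Y` flat.
[cite: KatzMazur1985, A7.1] [cite: MumfordFogartyKirwan1994, Ch. 1 §2 Thm. 1.1 (proof)] -/
theorem flat_of_isUnit_card [Finite G] (hq : ρ.IsGeometricQuotient p) [IsAffineHom p]
    (q : Q ⟶ Y) (hpq : p ≫ q = r) [Flat r] (hG : IsUnit ((Nat.card G : ℕ) : Γ(Q, ⊤))) : Flat q := by
  rw [HasRingHomProperty.iff_appLE (P := @Flat)]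
  intro U V hVU
  have hGV : IsUnit ((Nat.card G : ℕ) : Γ(Q, (V : Q.Opens))) := by
    simpa using hG.map (Q.presheaf.map (homOfLE (le_top (a := (V : Q.Opens)))).op).hom
  have hA₀ : IsAffineOpen (p ⁻¹ᵁ (V : Q.Opens)) := V.2.preimage p
  exact hq.flat_appLE_of_isUnit_card q hpq U V hVU hGV
    (HasRingHomProperty.appLE @Flat r inferInstance U ⟨_, hA₀⟩ _)

/-- The unit hypothesis may be supplied on the base: `|G| ∈ Γ(Y, 𝒪_Y)ˣ ⟹ |G| ∈ Γ(Q, 𝒪_Q)ˣ`.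
[folklore] -/
private theorem isUnit_natCast_top_of_base (q : Q ⟶ Y) (n : ℕ) (hG : IsUnit ((n : ℕ) : Γ(Y, ⊤))) :
    IsUnit ((n : ℕ) : Γ(Q, ⊤)) := by
  simpa using hG.map (q.appTop).hom

/-- **`X → Y` flat and `|G| ∈ Γ(Y, 𝒪_Y)ˣ` ⟹ `Q → Y` flat.** [cite: KatzMazur1985, A7.1] -/
theorem flat_of_isUnit_card_base [Finite G] (hq : ρ.IsGeometricQuotient p) [IsAffineHom p]
    (q : Q ⟶ Y) (hpq : p ≫ q = r) [Flat r] (hG : IsUnit ((Nat.card G : ℕ) : Γ(Y, ⊤))) : Flat q :=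
  hq.flat_of_isUnit_card q hpq (isUnit_natCast_top_of_base q _ hG)

/-- Over a locally Noetherian base, locally of finite type implies locally of finite presentation
(a copy of `HodgeTheory.locallyOfFinitePresentation_of_isLocallyNoetherian`, kept private here to keep
the `RelativeSpec` import cone small). [cite: StacksProject, Tag 01TX (context)] -/
private theorem locallyOfFinitePresentation_of_isLocallyNoetherian_aux
    {Q Y : Scheme.{u}} (q : Q ⟶ Y) [LocallyOfFiniteType q] [IsLocallyNoetherian Y] :
    LocallyOfFinitePresentation q := by
  rw [HasRingHomProperty.iff_appLE (P := @LocallyOfFinitePresentation)]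
  intro U V e
  haveI := IsLocallyNoetherian.component_noetherian (X := Y) U
  exact RingHom.FinitePresentation.of_finiteType.mp
    (HasRingHomProperty.appLE @LocallyOfFiniteType q inferInstance U V e)

end IsGeometricQuotient

/-! ### The glued quotient `X/G → Y` -/

section Glued

variable {X Y : Scheme.{u}} {r : X ⟶ Y} {G : Type*} [Group G] (ρ : ActionOver r G)
  [Finite G] [Y.IsSeparated] [IsSeparated r] (hcov : ∀ x : X, ∃ O : ρ.StableAffineOpens, x ∈ O.1)

set_option backward.isDefEq.respectTransparency false

include hcov in
/-- **The glued quotient `X/G → Y` is flat** over an affine base `Y` when `X → Y` is flat and `|G|` is a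
unit on `X` (e.g. `X` over `Spec O` with `|G| ∈ Oˣ`). [cite: KatzMazur1985, A7.1]
[cite: SGA1, Exp. V, Prop. 1.9 (remark)] -/
theorem flat_gluedDesc_of_isUnit_card [IsAffine Y] [Flat r]
    (hG : IsUnit ((Nat.card G : ℕ) : Γ(X, ⊤))) : Flat (ρ.gluedDesc r ρ.aut_comp) := by
  have hq := ρ.isGeometricQuotient_gluedMk hcov
  have hG' : IsUnit ((Nat.card G : ℕ) : Γ(ρ.glued, ⊤)) := by
    rw [IsGeometricQuotient.isUnit_natCast_iff ρ hq ⊤]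
    simpa using hG
  exact hq.flat_of_isUnit_card (ρ.gluedDesc r ρ.aut_comp) (ρ.gluedMk_gluedDesc hcov r ρ.aut_comp) hG'

include hcov in
/-- **The glued quotient `X/G → Y` is flat** over an affine base `Y` when `X → Y` is flat and
`|G| ∈ Γ(Y, 𝒪_Y)ˣ`. [cite: KatzMazur1985, A7.1] -/
theorem flat_gluedDesc_of_isUnit_card_base [IsAffine Y] [Flat r]
    (hG : IsUnit ((Nat.card G : ℕ) : Γ(Y, ⊤))) : Flat (ρ.gluedDesc r ρ.aut_comp) :=
  ρ.flat_gluedDesc_of_isUnit_card hcov (by simpa using hG.map (r.appTop).hom)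

/-- **`X/G → Y` is locally of finite presentation** when `X → Y` is locally of finite type over a
locally Noetherian `Y` («si `X` est de type fini sur `Y` localement noethérien, `X/G` est de type fini
sur `Y`», ★ `locallyOfFiniteType_gluedDesc_base`, and finite type = finite presentation over a
Noetherian ring). [cite: SGA1, Exp. V, Cor. 1.5] [cite: StacksProject, Tag 01TX (context)] -/
theorem locallyOfFinitePresentation_gluedDesc [LocallyOfFiniteType r] [IsLocallyNoetherian Y] :
    LocallyOfFinitePresentation (ρ.gluedDesc r ρ.aut_comp) := by
  haveI := ρ.locallyOfFiniteType_gluedDesc_base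
  exact IsGeometricQuotient.locallyOfFinitePresentation_of_isLocallyNoetherian_aux _

end Glued

end ActionOver

end Literature.AlgebraicGeometry.RelativeSpec

end
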